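import Mathlib
import HarnessLib

/-!
# `t`-adically prevaluative local domains are pinchings of a local ring along a valuation ring
# (Abbes–Saito 2011, Lemma 2.19 (ii)–(iv) = [EGR1] 1.9.4; crux `WildQuotients.WildQuotientResolution`,
# stub `stub_phaseZeroHighDim`: step (P6') of the port of (H1))

Crux stmt-ResolutionOfSingularities-15640 (`WildQuotientResolution`), registered stub `stub_phaseZeroHighDim`,
residual (H1) = Abbes–Saito 2011 Prop. 2.22. Its Lemma 2.19: the local ring `O_ξ` of a point `ξ` of the
Zariski–Riemann space of a pair `(X, U = X − V(t))` — the union of the local rings `O_{X',x'}` at the centres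
of `ξ` on all `U`-admissible blow-ups — is **`t`-adically prevaluative** ([EGR1] 1.9.1: local, and every
finitely generated `t`-OPEN ideal, i.e. containing a power of `t`, is invertible; for `O_ξ` because such an
ideal becomes invertible after one more admissible blow-up), and CONSEQUENTLY (2.19 (ii)–(iv), [EGR1] 1.9.4):
with `𝔭 = ⋂ₙ tⁿ O_ξ`, the ring `O_ξ[1/t] = (O_ξ)_𝔭` is local, `O_ξ/𝔭` is a valuation ring, and
`𝔭 (O_ξ)_𝔭 ⊆ O_ξ` — i.e. `O_ξ` is the PINCHING of the local ring `(O_ξ)_𝔭` along the valuation ring `O_ξ/𝔭`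
of its residue field. This file proves that consequence as pure commutative algebra, for a local DOMAIN `O`,
a non-zero non-unit `t ∈ O`, and the hypothesis

  `(hpv) every finitely generated ideal of O containing a power of t is principal`

(`prevaluative`; in a local domain "invertible" = "principal"):

* `dvd_or_dvd_of_isPrincipal` — in a local domain, if `(x, y)` is principal then `x ∣ y` or `y ∣ x`;
* `dvd_pow_of_not_mem` — every `x ∉ 𝔭` divides a power of `t` (so becomes a unit in `O[1/t]`: `O[1/t] = O_𝔭`);
* `pow_not_mem`, `isPrime_iInf_span_pow` — `tⁿ ∉ 𝔭`, and `𝔭` is a prime ideal;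
* `dvd_total_of_not_mem` — for `x ∉ 𝔭` and any `y`, `x ∣ y` or `y ∣ x`; hence `preValuationRing_quotient`,
  `valuationRing_quotient` — **`O/𝔭` is a valuation ring**;
* `exists_eq_mul_of_mem_of_not_mem` — **`𝔭 O_𝔭 ⊆ O`**: for `p ∈ 𝔭`, `s ∉ 𝔭` there is `q ∈ 𝔭` with `p = s q`.

[OURS · crux stmt-ResolutionOfSingularities-15640 · helper toward `stub_phaseZeroHighDim` (step P6' of the port
of the named fact (H1), evidence memo PHASE0-H1-PORTPLAN.md; NOT a proof of the stub); counted 0; AI-level work,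
weaker than expert review.] [cite: AbbesSaito2011, Lemma 2.19] (A. Abbes, *Éléments de géométrie rigide* I,
1.9.1, 1.9.4) [folklore]
-/

-- single-problem summit: the doubled namespace component `ResolutionOfSingularities` is forced
set_option linter.dupNamespace false

noncomputable section

namespace Summit.ResolutionOfSingularities.ResolutionOfSingularities.Theorems.WildQuotientResolution.PrevaluativeRing

universe u

variable {O : Type u} [CommRing O] [IsDomain O] [IsLocalRing O]

/-- In a local domain, if the ideal `(x, y)` is principal then `x ∣ y` or `y ∣ x` (trivial if `x = 0`; else
writing `x = d x'`, `y = d y'`, `d = a x + b y` gives `a x' + b y' = 1`, so `x'` or `y'` is a unit).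
[folklore] -/
theorem dvd_or_dvd_of_isPrincipal {x y : O}
    (h : (Ideal.span {x, y}).IsPrincipal) : x ∣ y ∨ y ∣ x := by
  by_cases hx0 : x = 0
  · exact Or.inr (hx0 ▸ dvd_zero y)
  obtain ⟨d, hd⟩ := h
  have hx : x ∈ Ideal.span {d} := by
    rw [← Ideal.submodule_span_eq, ← hd]; exact Ideal.subset_span (Set.mem_insert _ _)
  have hy : y ∈ Ideal.span {d} := by
    rw [← Ideal.submodule_span_eq, ← hd]
    exact Ideal.subset_span (Set.mem_insert_of_mem _ (Set.mem_singleton _))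
  have hdmem : d ∈ Ideal.span {x, y} := by
    rw [hd]; exact Ideal.mem_span_singleton_self d
  obtain ⟨x', hx'⟩ := Ideal.mem_span_singleton'.mp hx
  obtain ⟨y', hy'⟩ := Ideal.mem_span_singleton'.mp hy
  obtain ⟨a, b, hab⟩ := Ideal.mem_span_pair.mp hdmem
  -- `hx' : x' * d = x`, `hy' : y' * d = y`, `hab : a * x + b * y = d`
  have hd0 : d ≠ 0 := by rintro rfl; rw [mul_zero] at hx'; exact hx0 hx'.symm
  have h1 : a * x' + b * y' = 1 := by
    have : (a * x' + b * y') * d = 1 * d := by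
      rw [one_mul]; nth_rw 2 [← hab]; rw [← hx', ← hy']; ring
    exact mul_right_cancel₀ hd0 this
  rcases IsLocalRing.isUnit_or_isUnit_of_isUnit_add (h1 ▸ isUnit_one) with hu | hu
  · -- `x'` is a unit: `d = x x'⁻¹`, so `x ∣ d ∣ y`
    have hx'u : IsUnit x' := isUnit_of_mul_isUnit_right hu
    obtain ⟨u, hu'⟩ := hx'u
    left
    refine ⟨(↑u⁻¹ : O) * y', ?_⟩
    rw [← hy', ← hx', ← hu']
    calc y' * d = y' * d * (↑u * ↑u⁻¹) := by rw [Units.mul_inv, mul_one]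
      _ = ↑u * d * (↑u⁻¹ * y') := by ring
  · have hy'u : IsUnit y' := isUnit_of_mul_isUnit_right hu
    obtain ⟨u, hu'⟩ := hy'u
    right
    refine ⟨(↑u⁻¹ : O) * x', ?_⟩
    rw [← hy', ← hx', ← hu']
    calc x' * d = x' * d * (↑u * ↑u⁻¹) := by rw [Units.mul_inv, mul_one]
      _ = ↑u * d * (↑u⁻¹ * x') := by ring

variable (t : O)

-- The ideal `𝔭 = ⋂ₙ tⁿ O` of `t`-infinitely-divisible elements: no definition is introduced, we work
-- with `⨅ n, Ideal.span {t ^ n}` throughout.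

omit [IsDomain O] [IsLocalRing O] in
/-- Membership in `⋂ₙ (tⁿ)`. [folklore] -/
theorem mem_iInf_span_pow_iff {x : O} :
    x ∈ (⨅ n : ℕ, Ideal.span {t ^ n}) ↔ ∀ n : ℕ, t ^ n ∣ x := by
  rw [Ideal.mem_iInf]
  exact forall_congr' fun n => Ideal.mem_span_singleton

variable {t}
variable (ht : t ∈ IsLocalRing.maximalIdeal O) (ht0 : t ≠ 0)
  (hpv : ∀ I : Ideal O, I.FG → (∃ n : ℕ, t ^ n ∈ I) → I.IsPrincipal)

section
include hpv

/-- **Every element outside `𝔭 = ⋂ₙ (tⁿ)` divides a power of `t`** (so it becomes a unit in `O[1/t]`,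
whence `O[1/t] = O_𝔭` is local): if `x ∉ (tⁿ)` then `(x, tⁿ)` is principal and `tⁿ ∤ x`, so `x ∣ tⁿ`.
[cite: AbbesSaito2011, Lemma 2.19 (ii)] -/
theorem dvd_pow_of_not_mem {x : O} (hx : x ∉ (⨅ n : ℕ, Ideal.span {t ^ n})) : ∃ n : ℕ, x ∣ t ^ n := by
  classical
  rw [mem_iInf_span_pow_iff] at hx
  push Not at hx
  obtain ⟨n, hn⟩ := hx
  refine ⟨n, ?_⟩
  have hP : (Ideal.span {x, t ^ n}).IsPrincipal :=
    hpv _ ⟨{x, t ^ n}, by simp⟩ ⟨n, Ideal.subset_span (Set.mem_insert_of_mem _ (Set.mem_singleton _))⟩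
  rcases dvd_or_dvd_of_isPrincipal hP with h | h
  · exact h
  · exact absurd h hn

end

include ht ht0 in
/-- `tⁿ ∉ 𝔭 = ⋂ₖ (tᵏ)`: otherwise `tⁿ ∈ (tⁿ⁺¹)` and `t` would be a unit or zero. [folklore] -/
theorem pow_not_mem (n : ℕ) : t ^ n ∉ (⨅ k : ℕ, Ideal.span {t ^ k}) := by
  intro h
  rw [mem_iInf_span_pow_iff] at h
  obtain ⟨c, hc⟩ := h (n + 1)
  have h0 : t ^ n * (1 - t * c) = 0 := by
    rw [mul_sub, mul_one, ← mul_assoc, ← pow_succ, ← hc, sub_self]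
  rcases mul_eq_zero.mp h0 with h1 | h1
  · exact pow_ne_zero n ht0 h1
  · have hu : IsUnit t := IsUnit.of_mul_eq_one c (sub_eq_zero.mp h1).symm
    exact (IsLocalRing.mem_maximalIdeal t).mp ht hu

include ht ht0 hpv in
/-- **`𝔭 = ⋂ₙ (tⁿ)` is a prime ideal** (elements outside `𝔭` divide powers of `t`, and no power of `t`
lies in `𝔭`). [cite: AbbesSaito2011, Lemma 2.19 (iii)] -/
theorem isPrime_iInf_span_pow : (⨅ n : ℕ, Ideal.span {t ^ n} : Ideal O).IsPrime := by
  rw [Ideal.isPrime_iff]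
  refine ⟨fun htop => pow_not_mem ht ht0 0 (htop ▸ Submodule.mem_top), fun {x y} hxy => ?_⟩
  by_contra hcon
  push Not at hcon
  obtain ⟨n, hn⟩ := dvd_pow_of_not_mem hpv hcon.1
  obtain ⟨m, hm⟩ := dvd_pow_of_not_mem hpv hcon.2
  obtain ⟨c, hc⟩ := mul_dvd_mul hn hm
  refine pow_not_mem ht ht0 (n + m) ?_
  rw [pow_add, hc]
  exact Ideal.mul_mem_right _ _ hxy

include hpv in
/-- **Total divisibility outside `𝔭`**: if `x ∉ 𝔭` then for every `y`, `x ∣ y` or `y ∣ x` (`(x, y)` contains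
a power of `t`, hence is principal). [cite: AbbesSaito2011, Lemma 2.19 (iii)] -/
theorem dvd_total_of_not_mem {x : O} (hx : x ∉ (⨅ n : ℕ, Ideal.span {t ^ n})) (y : O) :
    x ∣ y ∨ y ∣ x := by
  classical
  obtain ⟨n, c, hc⟩ := dvd_pow_of_not_mem hpv hx
  refine dvd_or_dvd_of_isPrincipal (hpv _ ⟨{x, y}, by simp⟩ ⟨n, ?_⟩)
  rw [hc]
  exact Ideal.mul_mem_right _ _ (Ideal.subset_span (Set.mem_insert _ _))

include hpv in
/-- **`O/𝔭` is a (pre)valuation ring**: any two residue classes are comparable for divisibility.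
[cite: AbbesSaito2011, Lemma 2.19 (iii)] -/
theorem preValuationRing_quotient :
    PreValuationRing (O ⧸ (⨅ n : ℕ, Ideal.span {t ^ n} : Ideal O)) := by
  refine ⟨fun a b => ?_⟩
  obtain ⟨x, rfl⟩ := Ideal.Quotient.mk_surjective a
  obtain ⟨y, rfl⟩ := Ideal.Quotient.mk_surjective b
  by_cases hx : x ∈ (⨅ n : ℕ, Ideal.span {t ^ n} : Ideal O)
  · refine ⟨0, Or.inr ?_⟩
    rw [mul_zero, Ideal.Quotient.eq_zero_iff_mem.mpr hx]
  · rcases dvd_total_of_not_mem hpv hx y with ⟨c, hc⟩ | ⟨c, hc⟩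
    · exact ⟨Ideal.Quotient.mk _ c, Or.inl (by rw [← map_mul, hc])⟩
    · exact ⟨Ideal.Quotient.mk _ c, Or.inr (by rw [← map_mul, hc])⟩

include ht ht0 hpv in
/-- **`O/𝔭` is a valuation ring** (a domain, `𝔭` being prime, with total divisibility).
[cite: AbbesSaito2011, Lemma 2.19 (iii)] -/
theorem valuationRing_quotient :
    ∃ _ : (⨅ n : ℕ, Ideal.span {t ^ n} : Ideal O).IsPrime,
      ValuationRing (O ⧸ (⨅ n : ℕ, Ideal.span {t ^ n} : Ideal O)) := by
  haveI hP := isPrime_iInf_span_pow ht ht0 hpv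
  haveI := preValuationRing_quotient hpv
  exact ⟨hP, {}⟩

include ht0 hpv in
/-- **`𝔭 O_𝔭 ⊆ O`** ([EGR1] 1.9.4 / AS 2.19 (iv)): for `p ∈ 𝔭` and `s ∉ 𝔭` there is `q ∈ 𝔭` with `p = s q`
(`s ∣ tⁿ` and `p ∈ tⁿ 𝔭`). So `𝔭` is also the maximal ideal of the local ring `O_𝔭 = O[1/t]`, and `O` is the
pinching of `O_𝔭` along the valuation ring `O/𝔭` of its residue field. [cite: AbbesSaito2011, Lemma 2.19 (iv)] -/
theorem exists_eq_mul_of_mem_of_not_mem {p s : O}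
    (hp : p ∈ (⨅ n : ℕ, Ideal.span {t ^ n} : Ideal O)) (hs : s ∉ (⨅ n : ℕ, Ideal.span {t ^ n} : Ideal O)) :
    ∃ q ∈ (⨅ n : ℕ, Ideal.span {t ^ n} : Ideal O), p = s * q := by
  obtain ⟨n, c, hc⟩ := dvd_pow_of_not_mem hpv hs
  rw [mem_iInf_span_pow_iff] at hp
  obtain ⟨p', hp'⟩ := hp n
  refine ⟨c * p', ?_, by rw [hp', hc, mul_assoc]⟩
  rw [mem_iInf_span_pow_iff]
  intro k
  refine Dvd.dvd.mul_left ?_ c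
  obtain ⟨q, hq⟩ := hp (n + k)
  refine ⟨q, mul_left_cancel₀ (pow_ne_zero n ht0) ?_⟩
  rw [← hp', hq, pow_add, mul_assoc]

end Summit.ResolutionOfSingularities.ResolutionOfSingularities.Theorems.WildQuotientResolution.PrevaluativeRing

end
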